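import Summits.AtomisticToContinuum.BoseEinsteinCondensation.Theses.BECProbeMassFlow
import Literature.MathematicalPhysics.QuantumManyBody.PeriodicBoseGasTagged
import Literature.MathematicalPhysics.QuantumManyBody.PeriodicBoseGasMomentumSector
import Literature.MathematicalPhysics.QuantumManyBody.PeriodicBoseGasLemma33
import Literature.MathematicalPhysics.QuantumManyBody.BosonicFloor
import Literature.MathematicalPhysics.QuantumManyBody.PeriodicClusteringFromKyFanGap
import Literature.MathematicalPhysics.QuantumManyBody.CondensateOccupationStability
import Literature.MathematicalPhysics.QuantumManyBody.PeriodicGroundStateNondegenerateProofs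
import Literature.MathematicalPhysics.QuantumManyBody.BoseGasThermodynamicLimitRuelle
import Summits.AtomisticToContinuum.BoseEinsteinCondensation.Theorems.BECProbeMassFlowRecoilTransferZeroMomentumLift
import Summits.AtomisticToContinuum.BoseEinsteinCondensation.Theorems.BECProbeMassFlowRecoilTransferZeroMomentumDescent
import Summits.AtomisticToContinuum.BoseEinsteinCondensation.Theorems.BECProbeMassFlowRecoilTransferBoseZeroMomentumAttain
import Summits.AtomisticToContinuum.BoseEinsteinCondensation.Theorems.BECProbeMassFlowRecoilTransferGroundStatesTranslationInvariant
import Summits.AtomisticToContinuum.BoseEinsteinCondensation.Theorems.BECProbeMassFlowRecoilTransferNearMinimisersNearZeroMomentum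
import Summits.AtomisticToContinuum.BoseEinsteinCondensation.Theorems.BECProbeMassFlowCloudMomentumAtomFreeKyFanGapLocallyBounded
import Summits.AtomisticToContinuum.BoseEinsteinCondensation.Theorems.BECLatticeDepthHomotopyModeIdentificationKyFanGap
import HarnessLib

/-!
# Route `BECProbeMassFlow`, crux `RecoilTransfer` (stmt-AtomisticToContinuum-12311):
# the transfer at `κ = 1` from the zero-momentum sector to all Bose near-minimisers

Support file for the crux `RecoilTransfer` ("recoil costs at most ε"), line `registered` (skeleton
`Cruxes/RecoilTransfer/Lines/birth.lean`, v7), first of two files landing the sorry-free part of the skeleton.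
At `κ = 1` the tagged Hamiltonian IS the `(N+1)`-boson Hamiltonian (bosonic floor
`taggedPeriodicGroundStateEnergy_one_eq`); a floor `A ≥ a` on the zero-total-momentum tagged near-minimisers
of `H_1` becomes the floor `⟨Ω, n₀Ω⟩ ≥ (a - η)(N+1)` on ALL Bose near-minimisers in two ways:

* `recoilTransfer_boseTransfer_gap` — from a Ky Fan gap `2E₀ < kyFanTwo` (available for profiles locally
  bounded on `(0,∞)`: `kyFanGap_of_locallyBounded`, sibling crux, landed; and for integrable ones:
  `PeriodicGroundStateNondegenerateIntegrable_holds`): clustering of Bose near-minimisers modulo a phase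
  (`exists_phase_integral_norm_sub_sq_le_of_kyFanGap`), a condensed zero-momentum Bose near-minimiser at every
  slack (`stub_boseZeroMomentumAttain`, p156119) and `le_condensateOccupation_nearMinimiser_of_clustering`;
* `recoilTransfer_boseTransfer_nearZeroMomentum` — gap-free, from "every Bose near-minimiser is `L²`-close to a
  zero-total-momentum Bose near-minimiser", which `recoilTransfer_hardWallNearZeroMomentum` (registered name)
  supplies for HARD-WALL profiles from the landed `stub_groundStatesTranslationInvariant` (p159906: every
  maximal-form ground state is translation invariant — finite-dimensional-sublattice atom argument, no
  connectivity of the hard-sphere configuration space) and `stub_nearMinimisersNearZeroMomentum_of_invariant`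
  (p158523), plus the `2(N+1)‖·‖_{L²}` Lipschitz bound `condensateOccupation_le_add_of_sq_dist_le`.
-/

noncomputable section

open MeasureTheory Filter
open scoped ENNReal NNReal

namespace Summit.AtomisticToContinuum.BoseEinsteinCondensation.Theorems

open Literature.MathematicalPhysics.QuantumManyBody
open Literature.MathematicalPhysics.QuantumManyBody.BoseGas

/-! ### Glue II (sorry-free): from the `Q = 0` sector to all BOSE near-minimisers at `κ = 1` -/

/-- **Bose transfer at `κ = 1` (from B1′ and the tree's clustering).** Fix `(N, L)`, finite bosonic
`E₀ = periodicGroundStateEnergy v (N+1) L` and a Ky Fan gap `2E₀ < kyFanTwo`. If the zero-total-momentum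
tagged `δ'`-near-minimisers of `H_1` have `A ≥ a`, then for every `η > 0` some `δ₂ > 0` makes EVERY Bose
`δ₂`-near-minimiser `Ω` satisfy `⟨Ω, n₀Ω⟩ ≥ (a - η)(N+1)`. Proof: the gap gives clustering of Bose
near-minimisers modulo a phase (`exists_phase_integral_norm_sub_sq_le_of_kyFanGap`, parallelogram law); at
every slack there is a Bose near-minimiser of total momentum `0` (stub B1′), which as a tagged state
(`toTagged`, bosonic floor `taggedPeriodicGroundStateEnergy_one_eq`) carries the floor `A ≥ a`, i.e.
`n₀ = (N+1)A ≥ a(N+1)`; conclude with `le_condensateOccupation_nearMinimiser_of_clustering`. [folklore] -/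
theorem recoilTransfer_boseTransfer_gap {v : ℝ → ℝ≥0∞} (hv : Measurable v) {N : ℕ} {L : ℝ} (hL : 0 < L)
    (hE : periodicGroundStateEnergy v (N + 1) L ≠ ⊤)
    (hgap : 2 * periodicGroundStateEnergy v (N + 1) L < kyFanTwo v (N + 1) L)
    (a : ℝ) {η : ℝ} (hη : 0 < η)
    (hfloor : ∃ δ' : ℝ≥0∞, 0 < δ' ∧ ∀ Ψ : TaggedPeriodicTrialState N L, HasTotalMomentum 0 Ψ.ψ →
      taggedPeriodicEnergy v 1 Ψ ≤ taggedPeriodicGroundStateEnergy v 1 N L + δ' →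
        ENNReal.ofReal a ≤ taggedZeroModeOccupation N L Ψ.ψ) :
    ∃ δ₂ : ℝ≥0∞, 0 < δ₂ ∧ ∀ Ω : PeriodicTrialState (N + 1) L,
      periodicEnergy v Ω ≤ periodicGroundStateEnergy v (N + 1) L + δ₂ →
        ENNReal.ofReal ((a - η) * ((N + 1 : ℕ) : ℝ)) ≤ condensateOccupation (N + 1) L Ω.ψ := by
  obtain ⟨γ, hγ, hgap'⟩ := ModeIdentification.exists_ofReal_gap_of_two_mul_lt' hgap
  obtain ⟨δ', hδ', hfl⟩ := hfloor
  refine le_condensateOccupation_nearMinimiser_of_clustering hL v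
    (fun θ hθ => exists_phase_integral_norm_sub_sq_le_of_kyFanGap hv hγ hE hgap' hθ) (c := a) ?_ hη
  -- at every slack there is a condensed Bose near-minimiser: a zero-momentum one (stub B1′)
  intro δ hδ
  obtain ⟨Ω₀, hQ₀, hΩ₀⟩ := stub_boseZeroMomentumAttain v hv (N + 1) L hL (min δ δ') (lt_min hδ hδ')
  refine ⟨Ω₀, hΩ₀.trans (add_le_add le_rfl (min_le_left _ _)), ?_⟩
  have hΩ₀' : taggedPeriodicEnergy v 1 Ω₀.toTagged ≤
      taggedPeriodicGroundStateEnergy v 1 N L + δ' := by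
    rw [taggedPeriodicEnergy_one_toTagged, taggedPeriodicGroundStateEnergy_one_eq hv]
    exact hΩ₀.trans (add_le_add le_rfl (min_le_right _ _))
  have hQ₀' : HasTotalMomentum 0 Ω₀.toTagged.ψ := by
    rw [PeriodicTrialState.toTagged_ψ]; exact hQ₀
  have hocc := hfl Ω₀.toTagged hQ₀' hΩ₀'
  rw [PeriodicTrialState.toTagged_ψ] at hocc
  rw [← succ_mul_taggedZeroModeOccupation hL Ω₀.ψ]
  rcases le_or_gt 0 a with ha | ha
  · calc ENNReal.ofReal (a * ((N + 1 : ℕ) : ℝ))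
          = ENNReal.ofReal a * ((N + 1 : ℕ) : ℝ≥0∞) := by
            rw [ENNReal.ofReal_mul ha, ENNReal.ofReal_natCast]
        _ ≤ taggedZeroModeOccupation N L Ω₀.ψ * ((N + 1 : ℕ) : ℝ≥0∞) :=
            mul_le_mul' hocc le_rfl
        _ = (N + 1 : ℝ≥0∞) * taggedZeroModeOccupation N L Ω₀.ψ := by
            rw [mul_comm, Nat.cast_succ]
  · have hnp : a * ((N + 1 : ℕ) : ℝ) ≤ 0 :=
      mul_nonpos_of_nonpos_of_nonneg ha.le (Nat.cast_nonneg _)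
    rw [ENNReal.ofReal_of_nonpos hnp]
    exact bot_le

/-- **Bose transfer at `κ = 1`, gap-free form (hard walls; from stub D′).** Fix `(N, L)`. If every Bose
near-minimiser is `L²`-close to a zero-total-momentum Bose near-minimiser (the body of stub D′ at `(N, L)`),
and the zero-total-momentum tagged `δ'`-near-minimisers of `H_1` have `A ≥ a`, then for every `η > 0` some
`δ₂ > 0` makes EVERY Bose `δ₂`-near-minimiser `Ω` satisfy `⟨Ω, n₀Ω⟩ ≥ (a - η)(N+1)`: take `θ = (η/2)²`; the
zero-momentum companion `Ω₀` of `Ω` is, as a tagged state (`toTagged`, bosonic floor), a `δ'`-near-minimiser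
of `H_1`, so `n₀(Ω₀) = (N+1)A(Ω₀) ≥ a(N+1)`, and `n₀(Ω) ≥ n₀(Ω₀) - 2(N+1)√θ`
(`condensateOccupation_le_add_of_sq_dist_le`). [folklore] -/
theorem recoilTransfer_boseTransfer_nearZeroMomentum {v : ℝ → ℝ≥0∞} (hv : Measurable v) {N : ℕ} {L : ℝ}
    (hL : 0 < L)
    (hnear : ∀ θ : ℝ, 0 < θ → ∀ δ' : ℝ≥0∞, 0 < δ' → ∃ δ : ℝ≥0∞, 0 < δ ∧
      ∀ Ω : PeriodicTrialState (N + 1) L,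
        periodicEnergy v Ω ≤ periodicGroundStateEnergy v (N + 1) L + δ →
          ∃ Ω₀ : PeriodicTrialState (N + 1) L, HasTotalMomentum 0 Ω₀.ψ ∧
            periodicEnergy v Ω₀ ≤ periodicGroundStateEnergy v (N + 1) L + δ' ∧
            ∫ X in cellN (N + 1) L, ‖Ω.ψ X - Ω₀.ψ X‖ ^ 2 ≤ θ)
    (a : ℝ) {η : ℝ} (hη : 0 < η)
    (hfloor : ∃ δ' : ℝ≥0∞, 0 < δ' ∧ ∀ Ψ : TaggedPeriodicTrialState N L, HasTotalMomentum 0 Ψ.ψ →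
      taggedPeriodicEnergy v 1 Ψ ≤ taggedPeriodicGroundStateEnergy v 1 N L + δ' →
        ENNReal.ofReal a ≤ taggedZeroModeOccupation N L Ψ.ψ) :
    ∃ δ₂ : ℝ≥0∞, 0 < δ₂ ∧ ∀ Ω : PeriodicTrialState (N + 1) L,
      periodicEnergy v Ω ≤ periodicGroundStateEnergy v (N + 1) L + δ₂ →
        ENNReal.ofReal ((a - η) * ((N + 1 : ℕ) : ℝ)) ≤ condensateOccupation (N + 1) L Ω.ψ := by
  obtain ⟨δ', hδ', hfl⟩ := hfloor
  obtain ⟨δ, hδ, hΩ⟩ := hnear ((η / 2) ^ 2) (by positivity) δ' hδ'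
  refine ⟨δ, hδ, fun Ω hΩE => ?_⟩
  obtain ⟨Ω₀, hQ₀, hΩ₀E, hdist⟩ := hΩ Ω hΩE
  -- the floor on the zero-momentum companion
  have hΩ₀' : taggedPeriodicEnergy v 1 Ω₀.toTagged ≤
      taggedPeriodicGroundStateEnergy v 1 N L + δ' := by
    rw [taggedPeriodicEnergy_one_toTagged, taggedPeriodicGroundStateEnergy_one_eq hv]
    exact hΩ₀E
  have hQ₀' : HasTotalMomentum 0 Ω₀.toTagged.ψ := by
    rw [PeriodicTrialState.toTagged_ψ]; exact hQ₀
  have hocc := hfl Ω₀.toTagged hQ₀' hΩ₀'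
  rw [PeriodicTrialState.toTagged_ψ] at hocc
  have hn₀ : ENNReal.ofReal (a * ((N + 1 : ℕ) : ℝ)) ≤ condensateOccupation (N + 1) L Ω₀.ψ := by
    rw [← succ_mul_taggedZeroModeOccupation hL Ω₀.ψ]
    rcases le_or_gt 0 a with ha | ha
    · calc ENNReal.ofReal (a * ((N + 1 : ℕ) : ℝ))
            = ENNReal.ofReal a * ((N + 1 : ℕ) : ℝ≥0∞) := by
              rw [ENNReal.ofReal_mul ha, ENNReal.ofReal_natCast]
          _ ≤ taggedZeroModeOccupation N L Ω₀.ψ * ((N + 1 : ℕ) : ℝ≥0∞) :=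
              mul_le_mul' hocc le_rfl
          _ = (N + 1 : ℝ≥0∞) * taggedZeroModeOccupation N L Ω₀.ψ := by
              rw [mul_comm, Nat.cast_succ]
    · have hnp : a * ((N + 1 : ℕ) : ℝ) ≤ 0 :=
        mul_nonpos_of_nonpos_of_nonneg ha.le (Nat.cast_nonneg _)
      rw [ENNReal.ofReal_of_nonpos hnp]
      exact bot_le
  -- the Lipschitz bound `n₀(Ω₀) ≤ n₀(Ω) + 2(N+1)√θ`
  have hdist' : ∫ X in cellN (N + 1) L, ‖Ω₀.ψ X - Ω.ψ X‖ ^ 2 ≤ (η / 2) ^ 2 := by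
    refine le_trans (le_of_eq (integral_congr_ae (ae_of_all _ fun X => ?_))) hdist
    simp only [norm_sub_rev]
  have hlip := condensateOccupation_le_add_of_sq_dist_le hL Ω₀.contDiff.continuous
    Ω.contDiff.continuous Ω₀.norm_eq.le Ω.norm_eq.le hdist'
  rw [Real.sqrt_sq (by positivity)] at hlip
  refine ofReal_sub_mul_le_of_le_add hη.le (N + 1) (hn₀.trans (hlip.trans (le_of_eq ?_)))
  have h2 : 2 * ((N + 1 : ℕ) : ℝ) * (η / 2) = η * ((N + 1 : ℕ) : ℝ) := by ring
  rw [h2]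

/-! ### The hard-wall branch, assembled from the landed stubs D′α + D′β -/

/-- **Hard walls, assembled (old stub D′ of v5, now sorry-free from D′α + D′β): Bose near-minimisers are
close to zero-total-momentum Bose near-minimisers, at low density eventually in `N`** (in fact as soon as
`sideLength ρ (N+1) > 2R₀`; the hypotheses `∫ v = ∞`, "not locally bounded" only record the branch of the
composition in which this is used — the mechanism needs neither). [folklore] -/
theorem recoilTransfer_hardWallNearZeroMomentum :
    ∀ v : ℝ → ℝ≥0∞, IsRepulsiveFiniteRange v → (∫⁻ x : Space, v ‖x‖) = ⊤ →
      (¬ ∀ d : ℝ, 0 < d → ∃ M : ℝ≥0∞, M ≠ ⊤ ∧ ∀ r : ℝ, d < r → v r ≤ M) →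
      ∃ ρ₀ : ℝ, 0 < ρ₀ ∧ ∀ ρ : ℝ, 0 < ρ → ρ < ρ₀ → ∀ᶠ N : ℕ in Filter.atTop,
        periodicGroundStateEnergy v (N + 1) (sideLength ρ (N + 1)) ≠ ⊤ →
          ∀ θ : ℝ, 0 < θ → ∀ δ' : ℝ≥0∞, 0 < δ' → ∃ δ : ℝ≥0∞, 0 < δ ∧
            ∀ Ω : PeriodicTrialState (N + 1) (sideLength ρ (N + 1)),
              periodicEnergy v Ω ≤ periodicGroundStateEnergy v (N + 1) (sideLength ρ (N + 1)) + δ →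
                ∃ Ω₀ : PeriodicTrialState (N + 1) (sideLength ρ (N + 1)), HasTotalMomentum 0 Ω₀.ψ ∧
                  periodicEnergy v Ω₀ ≤
                      periodicGroundStateEnergy v (N + 1) (sideLength ρ (N + 1)) + δ' ∧
                  ∫ X in cellN (N + 1) (sideLength ρ (N + 1)), ‖Ω.ψ X - Ω₀.ψ X‖ ^ 2 ≤ θ := by
  intro v hv _ _
  obtain ⟨R₀, hR₀⟩ := hv.2
  refine ⟨1, one_pos, fun ρ hρ _ => ?_⟩
  have hLt : Tendsto (fun n : ℕ => sideLength ρ (n + 1)) atTop atTop :=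
    (tendsto_sideLength_atTop hρ).comp (tendsto_add_atTop_nat 1)
  filter_upwards [hLt.eventually_gt_atTop 0, hLt.eventually_gt_atTop (2 * R₀)] with N hL h2R
  intro hE
  exact stub_nearMinimisersNearZeroMomentum_of_invariant v hv R₀ hR₀ (N + 1) _ hL h2R hE
    (stub_groundStatesTranslationInvariant v hv R₀ hR₀ (N + 1) _ hL h2R hE)


end Summit.AtomisticToContinuum.BoseEinsteinCondensation.Theorems

end
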